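import Literature.AlgebraicGeometry.HodgeTheory.WeilClassesFieldExceptionalOfCentralTorus
import Literature.AlgebraicGeometry.HodgeTheory.WeilClassesFieldDecomposableOfMatrixBlocks
import Mathlib.LinearAlgebra.Dual.Lemmas
import HarnessLib

/-!
# «`θ = 0` ⟹ `W_F` decomposable» on the carrier: Moonen–Zarhin's Criterion (2) for a CM centre acting through matrix
# units — `F ⊆ E` and `F ⊆ M_{n+1}(E)` on `A` and on `A^{n+1}` (Moonen–Zarhin 1998, §1 Criterion (2), type 4 with
# `d = 1`; Milne 1999, §1)

Layer `Literature/AlgebraicGeometry/HodgeTheory`; THEOREMS ONLY — no definition, no named fact, no `sorry` (D-0026, net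
debt 0).  The CONVERSE of the seat's `WeilClassesFieldExceptionalOfCentralTorus` (g22-#1: a multiplicity imbalance
`dim(V_ρ ∩ ker(ψ^* - σ)) ≠ dim(V_ρ ∩ ker(ψ†^* - σ))` ⟹ all non-zero Weil classes of `F` exceptional): here BALANCED
multiplicities ⟹ `W_F ⊗ ℂ ≤ 𝒟 ⊗ ℂ`, for `F` inside a matrix algebra over the CM field `E = ℚ(ψ)` acting on `H¹` through
`†`-adapted matrix units.  Together the two files are the print's dichotomy «`W_F` decomposable ⟺ `θ = 0`» for
`X ∼ Y^m`, `Y` of type 4 with `d = 1` (`End⁰(Y) = E`), every `m ≥ 1`, read on the carrier.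

## The print

B. J. J. Moonen, Yu. G. Zarhin, *Weil classes on abelian varieties*, J. reine angew. Math. **496** (1998) 83–92 =
arXiv:alg-geom/9612017 [MoonenZarhin1998WeilClasses] (held text `paper:arxiv-alg-geom_9612017`), §1, VERBATIM.
Criterion (2) (chunk p0003 L46–L60): «Let `X` be an abelian variety with `X ∼ Y^m`, where `Y` is simple of type 1–4.
Let `F` be a subfield of `End⁰(X)` … Then either all classes in `W_F` are decomposable or all non-zero classes in `W_F`
are exceptional; this last possibility occurs precisely in the following cases: … (c) `Y` is of Type 4 with `d ≥ 2` or
`m ≥ 2` and the map `θ : E₋ ↪ End_F(V_X) —Tr_F→ F` is non-zero», and for Type 4 with `d = 1`, `m = 1`: «decomposable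
if and only if `F ⊆ E₀`» (the maximal totally real subfield).  Proof (chunk p0003 L72–L80): «Next assume that `X` is of
type 4 with either `m ≥ 2` or `d ≥ 2`.  We have `F ⊆ B = End⁰(X)`.  Since in this case `G_div(X)` is connected (see
(Gdivprops)), it acts trivially on `W_F` if and only if the composition
`U_E = Z(G_div) ⊂ G_div(X) ↪ Gl_F(V_Y) —det_F→ F^*` is trivial.  The torus `U_E` being connected, this is the case if
and only if the induced map on Lie algebras `θ : E₋ ↪ End_F(V_X) —Tr_F→ F` is zero.»  Lemma (1)–(3) (chunk p0003
L1–L12): `Z(G_div) = U_{K_B}`, `G_div = Sp / O / U` of a `†`-hermitian form over `B`.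
J. S. Milne, *Lefschetz classes on abelian varieties*, Duke Math. J. 96 (1999) [Milne1999LefschetzClasses], §1
pp. 642–644 (`C(A)`, `S(A)`, «`C(A^r) = C(A)` diagonally»), Thm. 3.2, Cor. 4.5.

## The carrier dictionary (as in the seat's files)

`V = H¹(A(ℂ); ℂ) = complexBetti A.X 1`; `F = ℚ(φ)`, `P(φ) = 0`, `P ∈ ℤ[T]` monic irreducible of degree `e`, `e · 2m = 2 dim A`,
`V_ρ = ker(φ^* - ρ)`; `W_F ⊗ ℂ = weilClassesField A φ P (2m)`, `𝒟ᵐ ⊗ ℂ = divisorClassesSpan A.X A.dim m`; `h ∈ B¹ ⊗ ℂ`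
with `Q_h` non-degenerate; `G_div(X)(ℂ)` read as Milne's `S(A)(h)(ℂ) = unitaryCentralizerGroup A h`;
`det(u | V_ρ) = detOnEigenspace`.  THE CENTRE: an operator `T` in the `ℂ`-algebra generated by the pull-backs
(typically `ψ^*`), killed by `R ∈ ℤ[T]` monic irreducible over `ℚ` (`E = ℚ(ψ)`), with `Q_h`-adjoint `T'` a polynomial in
`T` («`ψ† ∈ E`») and `ker(T - σ) ∩ ker(T' - σ) = 0` for every `σ` («no real place on `H¹`»: `σ̄ ≠ σ` — `E` a CM field with
`†` = complex conjugation).  THE MATRIX ALGEBRA: operators `U_{ab}` (`a, b ∈ ι`) in the same algebra with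
`U_{ab} U_{cd} = δ_{bc} U_{ad}`, `Σ U_{aa} = 1`, `U_{ab}† = U_{ba}`, `[T, U_{ab}] = 0` — on `A^{n+1}` the pull-backs of
`πₐ ≫ ι_b` (the seat's `pullbackOne_π_comp_ι_mul`, `polarizationPairingOne_pullbackOne_π_comp_ι`); and
`φ^* ∈ ℂ⟨T, U_{ab}⟩` («`F ⊆ M_ι(E)`»).  BALANCE: `dim(V_ρ ∩ ker(T - σ)) = dim(V_ρ ∩ ker(T' - σ))` for all roots `ρ` of `P`
and all `σ` — the vanishing of «`θ`» read as an eigenvalue count (g22-#1, «Relation to the print»).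

## What is proved — for EVERY complex abelian variety (no Albert type, no simplicity, no connectedness)

* §0 (private) linear algebra: a PERFECT PAIRING `W₁ × W₂ → K` between two `u`-stable subspaces, `u` an isometry, forces
  `dim W₁ = dim W₂` and `det(u|W₁) · det(u|W₂) = 1` (`finrank_eq_and_det_mul_det_eq_one_of_pairing`, through
  `W₂ ≅ W₁^∨` and `LinearMap.det_dualMap`); roots of a monic integer polynomial irreducible over `ℚ` are simple with nodal
  polynomial the polynomial (`nodal_rootsFinset_eq_self'`); eigenbases with multiplicities; FUNCTIONS OF A DIAGONALISABLE
  OPERATOR (`exists_linearEquiv_apply_eq_smul`: an automorphism acting by prescribed non-zero weights `c(z)` on the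
  `ker(T - z)` and commuting with the commutant of `T` — a Lagrange polynomial in `T`).
* §2 **THE MECHANISM** (`CentralTorus.weilClassesField_le_divisorClassesSpan_of_matrixUnits_of_forall_finrank_eq`): under
  the dictionary above, BALANCE ⟹ `W_F ⊗ ℂ ≤ 𝒟ᵐ ⊗ ℂ`.  Proof, for `u ∈ S(A)(h)(ℂ)` and a root `τ` of `P`: with the
  spectral projectors `P_σ` of `T` (`aeval_lagrange_basis_spectral`) the blocks `x_{σ,a} = P_σ U_{a i₀}`,
  `y_{σ,a} = P_σ U_{i₀ a}` satisfy the relations of the seat's multi-block Morita lemma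
  (`Literature.LinearAlgebra.exists_det_restrict_eigenspace_eq_prod_pow`) and `φ^*` lies in their span
  (`adjoin_le_span_units_of_matrixBlocks`); the CORNERS `W_σ = P_σ U_{i₀i₀} V ⊆ ker(T - σ)` are `u`-stable and — since
  `ker(T - a) ⊥ ker(T - b)` unless `b = ā` (g22-#1 §1) and `U_{i₀i₀}† = U_{i₀i₀}` — PERFECTLY PAIRED `W_σ × W_σ̄ → ℂ` by
  `ℓ ∘ Q_h` (`ℓ` an injective functional on the top line, `Milne1999.exists_injective_linearMap_topDegree`), whence
  `dim W_σ = dim W_σ̄` and `det(u|W_σ̄) = det(u|W_σ)⁻¹` (§0); choosing ONE `dim W_σ`-th root `ζ_σ` of `det(u|W_σ)` per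
  conjugate pair (`σ` «chosen» iff `σ̄ <_lex σ`; `σ̄ ≠ σ` by the no-real-place hypothesis) and weights `c(σ) = ζ_σ`,
  `c(σ̄) = ζ_σ⁻¹`, the diagonal operator `t = Σ c(σ) P_σ` (§0) has `det(t⁻¹u | W_σ) = 1` on EVERY corner, so
  `det(t⁻¹u | V_τ) = ∏_σ det(t⁻¹u | W_σ)^{l_σ} = 1` by the Morita lemma, and
  `det(u | V_τ) = det(t | V_τ) = ∏_σ c(σ)^{dim(V_τ ∩ ker(T - σ))}` (g22-#1 §3 `CentralTorus.detOnEigenspace_eq_prod_pow_finrank`)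
  `= ∏_{pairs} (c(σ) c(σ̄))^{dim(V_τ ∩ ker(T-σ))} = 1` by the BALANCE (`ker(T' - σ) = ker(T - σ̄)`, g22-#1 §1;
  `Finset.prod_involution`).  Then the tree's
  `weilClassesField_le_divisorClassesSpan_of_forall_unitaryCentralizerGroup_detOnEigenspace_eq_one` (Milne 3.2/4.5 on
  the carrier).  This is the print's «`G_div` acts on `W_F` through `U_E —det_F→ F^*`» with the torus replaced by an
  explicit diagonal normalisation: no connectedness of `G_div`, no Lie algebra.  `…_le_algebraicClasses_…` by Lefschetz
  `(1,1)` (the tree's `lefschetzOneOne_rational_holds`).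
* §3 **`m = 1`, `F ⊆ E`** (`weilClassesField_le_divisorClassesSpan_of_mem_adjoin_of_forall_finrank_eq`, `ι = Unit`):
  `ψ, ψ' ∈ End(A)`, `R(ψ) = 0`, `ψ'^* ∈ ℂ[ψ^*]`, `Q_h(ψ^* x, y) = Q_h(x, ψ'^* y)`, no real place, `φ^* ∈ ℂ[ψ^*]`, balance
  ⟹ decomposable (and algebraic).  For `F ⊆ E₀` (`φ` Rosati-symmetric) the balance is automatic and the statement is the
  tree's `…OfSymmetric` row; the present form is the intrinsic «`θ|_F = 0`».
* §4 **POWERS** (`weilClassesField_biproduct_le_divisorClassesSpan_of_entry_eq_eval₂_of_forall_finrank_eq`): on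
  `X = A^{n+1}` with the product polarization `Σ πᵢ^* h` (`dim A > 0`, `h^{dim A} ≠ 0`), for `φ ∈ End(X)` with entries
  `ιₐ ≫ φ ≫ π_b = p_{ab}(ψ)` («`F ⊆ M_{n+1}(E)`») and balanced multiplicities of `(⊕ψ)^*` versus `(⊕ψ')^*` on the `V_ρ ⊆ H¹(X)`:
  `W_F(X) ⊗ ℂ ≤ 𝒟ᵐ(X) ⊗ ℂ` (and `≤ algebraicClasses`).  Slot lemmas: `map_ι_pullbackOne_biproductMap`
  (`ιᵢ^* (⊕g)^* = gᵢ^* ιᵢ^*`), `eigenspace_biproductMap_inf_eq_bot` (no real place survives on the power).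

Scope (honest column).  Type 4 with `d ≥ 2` (`End⁰(Y) = D` a division algebra of degree `d` over its CM centre `E`) is
covered by the MECHANISM of §2 exactly when `†`-adapted matrix units `U_{ab}` of `B ⊗ ℂ` commuting with `E` are supplied
in the `ℂ`-algebra of pull-backs; their existence (a splitting of `D ⊗_E ℂ` compatible with the positive involution) is
NOT derived here.  Types 1–3 (where `Z(G_div)` is finite and the answer is by parity/`Sp`/`O`) are the seat's earlier
rows, not this file.  `ψ'` is an honest endomorphism with `ψ'^* = (ψ^*)†` exactly (no denominators); the balance is an
assumption on `H¹`, not computed from a CM type.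

## References

* [MoonenZarhin1998WeilClasses] B. J. J. Moonen, Yu. G. Zarhin, Weil classes on abelian varieties, J. reine angew.
  Math. 496 (1998) 83–92; arXiv:alg-geom/9612017: §1 Lemma (1)–(3) (chunk p0003 L1–L45), Criterion (2) and its proof
  (chunk p0003 L46–L90).
* [Milne1999LefschetzClasses] J. S. Milne, Lefschetz classes on abelian varieties, Duke Math. J. 96 (1999) 639–675,
  §1 pp. 642–644, Thm. 3.2, Cor. 4.5.
* [LangeBirkenhake1992] H. Lange, Ch. Birkenhake, Complex Abelian Varieties, Grundlehren 302 (1992), §1.1 (rational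
  representation, functoriality), §5.1 (Rosati involution = adjoint), §5.3 (products).
* [McconnellRobson2001] J. C. McConnell, J. C. Robson, Noncommutative Noetherian Rings, GSM 30 (AMS 2001), 3.5.5–3.5.7
  (Morita context of a full idempotent; corners `eRe`).
* [VoisinHodgeI2002] C. Voisin, Hodge Theory and Complex Algebraic Geometry I (CUP 2002), Thm. 11.30 (Lefschetz (1,1)).
* [HornJohnson2013] R. A. Horn, C. R. Johnson, Matrix Analysis, 2nd ed. (CUP 2013), §0.8, §1.3 (determinant of the
  inverse transpose; functions of a diagonalisable operator).

## Provenance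

Lane `lit-hodgefound` (Track 2, Layer A), prover seat `lit-hodgefound-p21` (generation 22), row g22-#2; the converse
announced in the honest column of row g22-#1 (`WeilClassesFieldExceptionalOfCentralTorus`).
-/

noncomputable section

open CategoryTheory CategoryTheory.Limits Polynomial Module
open Literature.AlgebraicTopology.SingularHomology
open Literature.AlgebraicGeometry.Motives
open Literature.AlgebraicGeometry.VanGeemen1994 (hodgeClassSpan pullbackOne detOnEigenspace mapsTo_eigenspace_of_comm
  detOnEigenspace_mul detOnEigenspace_congr)
open Literature.AlgebraicGeometry.Milne1999
open Literature.AlgebraicGeometry.Pohlmann1968 (sum_map_π_map_ι)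
open Literature.Barriers.HodgeConjecture (divisorClassesSpan)
open Literature.Geometry.Kaehler (lefschetzPow)
open Literature.LinearAlgebra

namespace Literature.AlgebraicGeometry.HodgeTheory

namespace CentralTorus

/-! ### §0 Linear algebra (private) -/

section LinAlg

variable {K V : Type*} [Field K] [AddCommGroup V] [Module K V]

/-- **A perfect pairing between two invariant subspaces forces equal dimensions and inverse determinants.** If a bilinear
`Φ` restricts to a pairing `W₁ × W₂ → K` non-degenerate on both sides, then `dim W₁ = dim W₂`, and an endomorphism `u`
preserving `W₁`, `W₂` with `Φ(u w₁, u w₂) = Φ(w₁, w₂)` has `det(u | W₁) · det(u | W₂) = 1` (`u|_{W₂}` is the inverse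
transpose of `u|_{W₁}` through `W₂ ≅ W₁^∨`). [folklore] -/
private theorem finrank_eq_and_det_mul_det_eq_one_of_pairing [FiniteDimensional K V] (Φ : V →ₗ[K] V →ₗ[K] K)
    {W₁ W₂ : Submodule K V} (h₁ : ∀ w₁ ∈ W₁, (∀ w₂ ∈ W₂, Φ w₁ w₂ = 0) → w₁ = 0)
    (h₂ : ∀ w₂ ∈ W₂, (∀ w₁ ∈ W₁, Φ w₁ w₂ = 0) → w₂ = 0) {u : V →ₗ[K] V} (hu₁ : ∀ w ∈ W₁, u w ∈ W₁)
    (hu₂ : ∀ w ∈ W₂, u w ∈ W₂) (hiso : ∀ w₁ ∈ W₁, ∀ w₂ ∈ W₂, Φ (u w₁) (u w₂) = Φ w₁ w₂) :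
    Module.finrank K W₁ = Module.finrank K W₂ ∧
      LinearMap.det (u.restrict hu₁) * LinearMap.det (u.restrict hu₂) = 1 := by
  classical
  -- `β : W₂ → W₁^∨`, `γ : W₁ → W₂^∨`
  let β : W₂ →ₗ[K] Module.Dual K W₁ := (LinearMap.domRestrict' W₁).comp (Φ.flip.domRestrict W₂)
  let γ : W₁ →ₗ[K] Module.Dual K W₂ := (LinearMap.domRestrict' W₂).comp (Φ.domRestrict W₁)
  have hβ : ∀ (w₂ : W₂) (w₁ : W₁), β w₂ w₁ = Φ w₁ w₂ := fun _ _ ↦ rfl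
  have hγ : ∀ (w₁ : W₁) (w₂ : W₂), γ w₁ w₂ = Φ w₁ w₂ := fun _ _ ↦ rfl
  have hβinj : Function.Injective β := by
    rw [injective_iff_map_eq_zero]
    intro w₂ hw
    exact Subtype.ext (h₂ w₂ w₂.2 fun w₁ hw₁ ↦ by
      have e := LinearMap.congr_fun hw ⟨w₁, hw₁⟩
      rwa [hβ, LinearMap.zero_apply] at e)
  have hγinj : Function.Injective γ := by
    rw [injective_iff_map_eq_zero]
    intro w₁ hw
    exact Subtype.ext (h₁ w₁ w₁.2 fun w₂ hw₂ ↦ by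
      have e := LinearMap.congr_fun hw ⟨w₂, hw₂⟩
      rwa [hγ, LinearMap.zero_apply] at e)
  have hdim : Module.finrank K W₁ = Module.finrank K W₂ := by
    refine le_antisymm ?_ ?_
    · have e := LinearMap.finrank_le_finrank_of_injective hγinj
      rwa [Subspace.dual_finrank_eq] at e
    · have e := LinearMap.finrank_le_finrank_of_injective hβinj
      rwa [Subspace.dual_finrank_eq] at e
  refine ⟨hdim, ?_⟩
  have hdim' : Module.finrank K W₂ = Module.finrank K (Module.Dual K W₁) := by rw [Subspace.dual_finrank_eq, hdim]
  let eβ : W₂ ≃ₗ[K] Module.Dual K W₁ := LinearMap.linearEquivOfInjective β hβinj hdim'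
  have heβ : ∀ w₂, eβ w₂ = β w₂ := fun w₂ ↦ LinearMap.linearEquivOfInjective_apply hβinj hdim' w₂
  set u₁ := u.restrict hu₁ with hu₁def
  set u₂ := u.restrict hu₂ with hu₂def
  -- `u₁ᵀ ∘ (eβ u₂ eβ⁻¹) = id`
  have key : u₁.dualMap ∘ₗ ((eβ : W₂ →ₗ[K] Module.Dual K W₁) ∘ₗ u₂ ∘ₗ (eβ.symm : Module.Dual K W₁ →ₗ[K] W₂)) =
      LinearMap.id := by
    refine LinearMap.ext fun x ↦ ?_
    obtain ⟨w₂, rfl⟩ := eβ.surjective x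
    refine LinearMap.ext fun w₁ ↦ ?_
    rw [LinearMap.comp_apply, LinearMap.comp_apply, LinearMap.comp_apply, LinearEquiv.coe_coe, LinearEquiv.coe_coe,
      eβ.symm_apply_apply, LinearMap.dualMap_apply, LinearMap.id_apply, heβ, heβ, hβ, hβ, hu₂def, hu₁def,
      LinearMap.coe_restrict_apply, LinearMap.coe_restrict_apply]
    exact hiso _ w₁.2 _ w₂.2
  have hdet := congrArg LinearMap.det key
  rw [LinearMap.det_comp, LinearMap.det_id, LinearMap.det_dualMap, LinearMap.det_conj] at hdet
  exact hdet

/-- The complex roots of a monic integer polynomial irreducible over `ℚ` are simple and non-empty, with nodal polynomial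
the polynomial itself. [folklore] -/
private theorem nodal_rootsFinset_eq_self' {Q : Polynomial ℤ} (hQm : Q.Monic)
    (hQirr : Irreducible (Q.map (Int.castRingHom ℚ))) :
    Lagrange.nodal (Q.map (Int.castRingHom ℂ)).roots.toFinset id = Q.map (Int.castRingHom ℂ) ∧
      (Q.map (Int.castRingHom ℂ)).roots.toFinset.Nonempty := by
  classical
  have hQc : Q.map (Int.castRingHom ℂ) = (Q.map (Int.castRingHom ℚ)).map (algebraMap ℚ ℂ) := by
    rw [Polynomial.map_map, RingHom.ext_int ((algebraMap ℚ ℂ).comp (Int.castRingHom ℚ)) (Int.castRingHom ℂ)]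
  have hsep : (Q.map (Int.castRingHom ℂ)).Separable := by
    rw [hQc]
    exact hQirr.separable.map
  have hmon : (Q.map (Int.castRingHom ℂ)).Monic := hQm.map _
  have hnodup : (Q.map (Int.castRingHom ℂ)).roots.Nodup := Polynomial.nodup_roots hsep
  refine ⟨?_, ?_⟩
  · have hsplit := (IsAlgClosed.splits (Q.map (Int.castRingHom ℂ))).eq_prod_roots_of_monic hmon
    rw [Lagrange.nodal_eq, ← Multiset.toFinset_eq hnodup, Finset.prod_mk]
    exact hsplit.symm
  · have hdeg : (Q.map (Int.castRingHom ℂ)).degree ≠ 0 := by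
      have h1 : 0 < (Q.map (Int.castRingHom ℚ)).natDegree :=
        Polynomial.natDegree_pos_iff_degree_pos.2 (Polynomial.degree_pos_of_irreducible hQirr)
      rw [hQm.natDegree_map] at h1
      intro h0
      rw [Polynomial.degree_eq_natDegree hmon.ne_zero, hQm.natDegree_map] at h0
      exact h1.ne' (by exact_mod_cast h0)
    obtain ⟨z, hz⟩ := IsAlgClosed.exists_root _ hdeg
    exact ⟨z, Multiset.mem_toFinset.2 ((Polynomial.mem_roots hmon.ne_zero).2 hz)⟩

/-- A polynomial `R ∈ ℤ[T]` irreducible over `ℚ` is square-free over `ℂ`. [folklore] -/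
private theorem squarefree_map_complex {R : Polynomial ℤ} (hRirr : Irreducible (R.map (Int.castRingHom ℚ))) :
    Squarefree (R.map (Int.castRingHom ℂ)) := by
  rw [map_castRingHom_complex_eq]
  exact hRirr.separable.map.squarefree

/-- `q(T) x = q(μ) x` on `ker(T - μ)`. [folklore] -/
private theorem aeval_apply_of_mem_eigenspace' {M : Type*} [AddCommGroup M] [Module ℂ M] {T : Module.End ℂ M} {μ : ℂ}
    {x : M} (hx : x ∈ T.eigenspace μ) (q : ℂ[X]) : aeval T q x = q.eval μ • x := by
  by_cases hx0 : x = 0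
  · rw [hx0, map_zero, smul_zero]
  · exact Module.End.aeval_apply_of_hasEigenvector (Module.End.hasEigenvector_iff.2 ⟨hx, hx0⟩)

/-- The eigenvalues of an operator killed by `R` are roots of `R`. [folklore] -/
private theorem isRoot_of_eigenspace_ne_bot' {M : Type*} [AddCommGroup M] [Module ℂ M] {T : Module.End ℂ M} {R : ℂ[X]}
    (hTR : aeval T R = 0) {μ : ℂ} (hμ : T.eigenspace μ ≠ ⊥) : R.IsRoot μ := by
  obtain ⟨v, hv, hv0⟩ := (Submodule.ne_bot_iff _).1 hμ
  have h := Module.End.aeval_apply_of_hasEigenvector (f := T) (p := R) (Module.End.hasEigenvector_iff.2 ⟨hv, hv0⟩)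
  rw [hTR, LinearMap.zero_apply] at h
  exact (smul_eq_zero.1 h.symm).resolve_right hv0

/-- An operator commuting with `T` commutes with every `q(T)`. [folklore] -/
private theorem aeval_mul_eq_mul_aeval_of_comm' {M : Type*} [AddCommGroup M] [Module ℂ M] {T S : Module.End ℂ M}
    (hc : S * T = T * S) (q : ℂ[X]) : aeval T q * S = S * aeval T q := by
  have hS : S ∈ Subalgebra.centralizer ℂ ({T} : Set (Module.End ℂ M)) := by
    rw [Subalgebra.mem_centralizer_iff]
    rintro _ rfl
    exact hc.symm
  have hq := Algebra.adjoin_le_centralizer_centralizer ℂ ({T} : Set (Module.End ℂ M))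
    (Polynomial.aeval_mem_adjoin_singleton ℂ T (p := q))
  rw [Subalgebra.mem_centralizer_iff] at hq
  exact (hq S hS).symm

/-- **`M = ⊕_{R(z) = 0} ker(T - z)`** for an operator `T` killed by a square-free polynomial `R ≠ 0` over `ℂ`. [folklore] -/
private theorem isInternal_eigenspace_of_aeval_eq_zero' {M : Type*} [AddCommGroup M] [Module ℂ M] [FiniteDimensional ℂ M]
    {T : Module.End ℂ M} {R : ℂ[X]} (hRsq : Squarefree R) (hTR : aeval T R = 0) :
    DirectSum.IsInternal fun z : R.roots.toFinset ↦ T.eigenspace (z : ℂ) := by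
  classical
  have hss : T.IsSemisimple := Module.End.isSemisimple_of_squarefree_aeval_eq_zero hRsq hTR
  have htop : ⨆ μ, T.eigenspace μ = ⊤ := hss.iSup_eigenspace_eq_top
  have hind : iSupIndep fun z : R.roots.toFinset ↦ T.eigenspace (z : ℂ) :=
    (Module.End.eigenspaces_iSupIndep T).comp Subtype.val_injective
  have hsup : (⨆ z : R.roots.toFinset, T.eigenspace (z : ℂ)) = ⊤ := by
    refine le_antisymm le_top ?_
    rw [← htop]
    refine iSup_le fun μ ↦ ?_
    by_cases hμ : T.eigenspace μ = ⊥
    · rw [hμ]; exact bot_le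
    · exact le_iSup (fun z : R.roots.toFinset ↦ T.eigenspace (z : ℂ))
        ⟨μ, Multiset.mem_toFinset.2 ((Polynomial.mem_roots hRsq.ne_zero).2 (isRoot_of_eigenspace_ne_bot' hTR hμ))⟩
  exact DirectSum.isInternal_submodule_of_iSupIndep_of_iSup_eq_top hind hsup

/-- An eigenbasis with multiplicities for `T` killed by a square-free `R`. [folklore] -/
private theorem exists_eigenbasis_sigma' {M : Type*} [AddCommGroup M] [Module ℂ M] [FiniteDimensional ℂ M]
    {T : Module.End ℂ M} {R : ℂ[X]} (hRsq : Squarefree R) (hTR : aeval T R = 0) :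
    ∃ (b : Module.Basis (Σ z : R.roots.toFinset, Fin (Module.finrank ℂ ↥(T.eigenspace (z : ℂ)))) ℂ M)
      (ev : (Σ z : R.roots.toFinset, Fin (Module.finrank ℂ ↥(T.eigenspace (z : ℂ)))) → ℂ),
      (∀ j, ev j = (j.1 : ℂ)) ∧ ∀ j, b j ∈ T.eigenspace (ev j) := by
  classical
  have hint := isInternal_eigenspace_of_aeval_eq_zero' hRsq hTR
  exact ⟨hint.collectedBasis fun z ↦ Module.finBasis ℂ ↥(T.eigenspace (z : ℂ)), fun j ↦ (j.1 : ℂ), fun _ ↦ rfl,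
    fun j ↦ hint.collectedBasis_mem _ j⟩

/-- **Functions of a diagonalisable operator**: for `T` killed by a square-free `R` and weights `c` non-zero on the
spectrum, an automorphism `t` acting by `c(z)` on each `ker(T - z)` and commuting with every operator commuting with `T`
(a Lagrange polynomial in `T`). [folklore] -/
private theorem exists_linearEquiv_apply_eq_smul {M : Type*} [AddCommGroup M] [Module ℂ M] [FiniteDimensional ℂ M]
    {T : Module.End ℂ M} {R : ℂ[X]} (hRsq : Squarefree R) (hTR : aeval T R = 0) {c : ℂ → ℂ}
    (hc : ∀ z, T.eigenspace z ≠ ⊥ → c z ≠ 0) :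
    ∃ t : M ≃ₗ[ℂ] M, (∀ (z : ℂ), ∀ x ∈ T.eigenspace z, t x = c z • x) ∧
      ∀ S : Module.End ℂ M, S * T = T * S → ∀ x, t (S x) = S (t x) := by
  classical
  set Z : Finset ℂ := R.roots.toFinset with hZdef
  have hmemZ : ∀ {z : ℂ} {x : M}, x ∈ T.eigenspace z → x ≠ 0 → z ∈ Z := fun {z x} hx hx0 ↦
    Multiset.mem_toFinset.2 ((Polynomial.mem_roots hRsq.ne_zero).2
      (isRoot_of_eigenspace_ne_bot' hTR ((Submodule.ne_bot_iff _).2 ⟨x, hx, hx0⟩)))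
  set p : ℂ[X] := Lagrange.interpolate Z id c with hpdef
  set p' : ℂ[X] := Lagrange.interpolate Z id (fun z ↦ (c z)⁻¹) with hp'def
  have hp : ∀ z ∈ Z, p.eval z = c z := fun z hz ↦ Lagrange.eval_interpolate_at_node c (Set.injOn_id _) hz
  have hp' : ∀ z ∈ Z, p'.eval z = (c z)⁻¹ := fun z hz ↦ Lagrange.eval_interpolate_at_node _ (Set.injOn_id _) hz
  set uL : Module.End ℂ M := aeval T p with huLdef
  set uL' : Module.End ℂ M := aeval T p' with huL'def
  have huL : ∀ (z : ℂ), ∀ x ∈ T.eigenspace z, uL x = c z • x := by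
    intro z x hx
    by_cases hx0 : x = 0
    · rw [hx0, map_zero, smul_zero]
    · rw [huLdef, aeval_apply_of_mem_eigenspace' hx, hp z (hmemZ hx hx0)]
  have huL' : ∀ (z : ℂ), ∀ x ∈ T.eigenspace z, uL' x = (c z)⁻¹ • x := by
    intro z x hx
    by_cases hx0 : x = 0
    · rw [hx0, map_zero, smul_zero]
    · rw [huL'def, aeval_apply_of_mem_eigenspace' hx, hp' z (hmemZ hx hx0)]
  obtain ⟨b, ev, -, hb⟩ := exists_eigenbasis_sigma' hRsq hTR
  have hspec : ∀ j, T.eigenspace (ev j) ≠ ⊥ := fun j ↦ (Submodule.ne_bot_iff _).2 ⟨b j, hb j, b.ne_zero j⟩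
  have h1 : uL * uL' = 1 := b.ext fun j ↦ by
    rw [Module.End.mul_apply, huL' _ _ (hb j), map_smul, huL _ _ (hb j), smul_smul, inv_mul_cancel₀ (hc _ (hspec j)),
      one_smul, Module.End.one_apply]
  have h2 : uL' * uL = 1 := b.ext fun j ↦ by
    rw [Module.End.mul_apply, huL _ _ (hb j), map_smul, huL' _ _ (hb j), smul_smul, mul_inv_cancel₀ (hc _ (hspec j)),
      one_smul, Module.End.one_apply]
  let t : M ≃ₗ[ℂ] M :=
    LinearEquiv.ofLinear uL uL' (by rw [← Module.End.mul_eq_comp, h1]; rfl) (by rw [← Module.End.mul_eq_comp, h2]; rfl)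
  have ht : ∀ x, t x = uL x := fun _ ↦ rfl
  refine ⟨t, fun z x hx ↦ by rw [ht]; exact huL z x hx, fun S hS x ↦ ?_⟩
  rw [ht, ht]
  have e := LinearMap.congr_fun (aeval_mul_eq_mul_aeval_of_comm' hS p) x
  rw [Module.End.mul_apply, Module.End.mul_apply] at e
  rw [huLdef]
  exact e

end LinAlg


/-! ### §2 THE MECHANISM: matrix units commuting with `T`, `F ⊆ M_ι(ℂ[T])`, balanced multiplicities ⟹ `G_div(X) ⊆ Sl_F` -/

section Mechanism

variable {A : AbelianVariety ℂ} {h : complexBetti A.X 2} {φ : A ⟶ A} {P R : Polynomial ℤ} {e m : ℕ}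
  {T T' : Module.End ℂ (complexBetti A.X 1)} {ι : Type*} [Fintype ι] [DecidableEq ι]
  {U : ι → ι → Module.End ℂ (complexBetti A.X 1)}

/-- **`det(u | V_τ) = 1` FOR EVERY `u ∈ S(A)(h)(ℂ)` — MOONEN–ZARHIN's «`θ = 0` ⟹ `G_div(X)` acts trivially on `W_F`» ON
THE CARRIER, for a CM centre acting through matrix units.**  Data on a complex abelian variety `A` with `h ∈ B¹ ⊗ ℂ`, `Q_h`
non-degenerate: an operator `T` in the `ℂ`-algebra generated by the pull-backs (e.g. `ψ^*`) killed by `R ∈ ℤ[T]` monic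
irreducible over `ℚ` (`E = ℚ(ψ)`), whose `Q_h`-adjoint `T'` is a polynomial in `T` («`ψ† ∈ E`») with
`ker(T - σ) ∩ ker(T' - σ) = 0` for all `σ` («`E` has no real place on `H¹`»: `σ̄ ≠ σ`); operators `U_{ab}` (`a, b ∈ ι`,
`i₀ ∈ ι`) in the same algebra which are MATRIX UNITS (`U_{ab} U_{cd} = δ_{bc} U_{ad}`, `Σ U_{aa} = 1`) with
`U_{ab}† = U_{ba}`, commuting with `T`; `F = ℚ(φ)` with `φ^* ∈ ℂ⟨T, U_{ab}⟩` («`F ⊆ M_ι(E)`»), `P(φ) = 0`,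
`deg P · 2m = 2 dim A`.  IF the multiplicities are BALANCED —
`dim(V_ρ ∩ ker(T - σ)) = dim(V_ρ ∩ ker(T' - σ))` for every root `ρ` of `P` and every `σ` — THEN `W_F ⊗ ℂ ≤ 𝒟ᵐ ⊗ ℂ`:
all Weil classes of `F` are decomposable (hence algebraic).  Proof («`U_E = Z(G_div) ⊂ G_div ↪ Gl_F(V_Y) → F^*`»): for
`u ∈ S(A)(h)(ℂ)` the corners `W_σ = P_σ E_{i₀i₀}^* V` (`P_σ` the spectral projectors of `T`) are perfectly paired
`W_σ × W_σ̄ → ℂ` by `Q_h`, so `dim W_σ = dim W_σ̄` and `det(u|W_σ̄) = det(u|W_σ)⁻¹`; a torus element `t ∈ U_E(ℂ)` (§1) with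
`t|_{W_σ}` scalar and `det(t|W_σ) = det(u|W_σ)` exists (`k`-th roots, one per conjugate pair); `t⁻¹u` has determinant `1`
on every corner, hence on `V_ρ` by the seat's multi-block Morita lemma
`Literature.LinearAlgebra.exists_det_restrict_eigenspace_eq_prod_pow`; and `det(t | V_ρ) = ∏_σ c_σ^{dim(V_ρ ∩ ker(T-σ))} = 1`
by the balance (`Finset.prod_involution` over `σ ↦ σ̄`).  Then the tree's
`weilClassesField_le_divisorClassesSpan_of_forall_unitaryCentralizerGroup_detOnEigenspace_eq_one`.
[cite: MoonenZarhin1998WeilClasses, §1 Criterion (2), case «Type 4 …» and its proof (chunk p0003 L46–L60, L72–L80); Lemma (1)–(3) (chunk p0003 L1–L12)]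
[cite: Milne1999LefschetzClasses, §1 pp. 642–644, Thm. 3.2, Cor. 4.5] [cite: McconnellRobson2001, 3.5.5–3.5.7] -/
theorem weilClassesField_le_divisorClassesSpan_of_matrixUnits_of_forall_finrank_eq (hPm : P.Monic) (hPe : P.natDegree = e)
    (hPirr : Irreducible (P.map (Int.castRingHom ℚ)))
    (hφ : Polynomial.eval₂ (Int.castRingHom (CategoryTheory.End A)) (φ : CategoryTheory.End A) P = 0)
    (her : e * (2 * m) = 2 * A.dim) (hh : h ∈ hodgeClassSpan A.dim A.X 1)
    (hnd : ∀ x : complexBetti A.X 1, (∀ y, polarizationPairingOne A.X h (A.dim - 1) x y = 0) → x = 0)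
    (hTe : T ∈ Algebra.adjoin ℂ (Set.range fun χ : A ⟶ A ↦ pullbackOne A χ))
    (hRm : R.Monic) (hRirr : Irreducible (R.map (Int.castRingHom ℚ))) (hTR : aeval T (R.map (Int.castRingHom ℂ)) = 0)
    (hT' : T' ∈ Algebra.adjoin ℂ ({T} : Set (Module.End ℂ (complexBetti A.X 1))))
    (hadj : ∀ x y : complexBetti A.X 1, polarizationPairingOne A.X h (A.dim - 1) (T x) y =
      polarizationPairingOne A.X h (A.dim - 1) x (T' y))
    (hCM : ∀ σ : ℂ, T.eigenspace σ ⊓ T'.eigenspace σ = ⊥) (i₀ : ι)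
    (hUe : ∀ a b, U a b ∈ Algebra.adjoin ℂ (Set.range fun χ : A ⟶ A ↦ pullbackOne A χ))
    (hUmul : ∀ a b c d, U a b * U c d = if b = c then U a d else 0) (hUsum : ∑ a, U a a = 1)
    (hUadj : ∀ a b (x y : complexBetti A.X 1), polarizationPairingOne A.X h (A.dim - 1) (U a b x) y =
      polarizationPairingOne A.X h (A.dim - 1) x (U b a y))
    (hUT : ∀ a b, T * U a b = U a b * T)
    (hF : pullbackOne A φ ∈ Algebra.adjoin ℂ (insert T (Set.range fun ab : ι × ι ↦ U ab.1 ab.2)))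
    (hbal : ∀ ρ : ℂ, Polynomial.eval₂ (Int.castRingHom ℂ) ρ P = 0 → ∀ σ : ℂ,
      Module.finrank ℂ ↥((pullbackOne A φ).eigenspace ρ ⊓ T.eigenspace σ) =
        Module.finrank ℂ ↥((pullbackOne A φ).eigenspace ρ ⊓ T'.eigenspace σ)) :
    weilClassesField A φ P (2 * m) ≤ divisorClassesSpan A.X A.dim m := by
  classical
  haveI : Module.Finite ℂ (complexBetti A.X 1) := abelianVarietyCohomologyExteriorH1_holds.finite_one A
  set F : Module.End ℂ (complexBetti A.X 1) := pullbackOne A φ with hFdef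
  -- every `u ∈ S(A)(h)(ℂ)` commutes with the `ℂ`-algebra generated by the pull-backs
  have hScomm : ∀ (w : complexBetti A.X 1 ≃ₗ[ℂ] complexBetti A.X 1), w ∈ unitaryCentralizerGroup A h →
      ∀ S ∈ Algebra.adjoin ℂ (Set.range fun χ : A ⟶ A ↦ pullbackOne A χ),
        (w : Module.End ℂ (complexBetti A.X 1)) * S = S * (w : Module.End ℂ (complexBetti A.X 1)) := by
    intro w hw S hS
    have hgen : (Set.range fun χ : A ⟶ A ↦ pullbackOne A χ) ⊆
        (Subalgebra.centralizer ℂ ({(w : Module.End ℂ (complexBetti A.X 1))} : Set _) : Set _) := by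
      rintro _ ⟨χ, rfl⟩
      rw [SetLike.mem_coe, Subalgebra.mem_centralizer_iff]
      rintro _ rfl
      exact LinearMap.ext fun v ↦ by
        rw [Module.End.mul_apply, Module.End.mul_apply, LinearEquiv.coe_coe, hw.1 χ v]
    have hS' := Algebra.adjoin_le hgen hS
    rw [Subalgebra.mem_centralizer_iff] at hS'
    exact hS' _ rfl
  have hRsq : Squarefree (R.map (Int.castRingHom ℂ)) := squarefree_map_complex hRirr
  obtain ⟨r, hr⟩ : ∃ r : ℂ[X], T' = aeval T r := by
    rw [Algebra.adjoin_singleton_eq_range_aeval] at hT'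
    obtain ⟨r, hr⟩ := hT'
    exact ⟨r, hr.symm⟩
  obtain ⟨hnodal, hs⟩ := nodal_rootsFinset_eq_self' hRm hRirr
  set s : Finset ℂ := (R.map (Int.castRingHom ℂ)).roots.toFinset with hsdef
  have hTs : aeval T (Lagrange.nodal s id) = 0 := by rw [hnodal]; exact hTR
  obtain ⟨hPsum, hPorth, hPidem, hTP⟩ := aeval_lagrange_basis_spectral T s hs hTs
  -- spectral bookkeeping for `T` and its adjoint `T' = r(T)`
  have hmem_s : ∀ {z : ℂ}, T.eigenspace z ≠ ⊥ → z ∈ s := fun hz ↦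
    Multiset.mem_toFinset.2 ((Polynomial.mem_roots hRsq.ne_zero).2 (isRoot_of_eigenspace_ne_bot' hTR hz))
  have hinv : ∀ σ, T.eigenspace σ ≠ ⊥ → T.eigenspace (r.eval σ) ≠ ⊥ ∧ r.eval (r.eval σ) = σ := fun σ hσ ↦
    eigenspace_eval_ne_bot hnd hRsq hTR hadj hr hσ
  have hT'eig : ∀ σ, T.eigenspace σ ≠ ⊥ → T'.eigenspace σ = T.eigenspace (r.eval σ) := fun σ hσ ↦
    eigenspace_adjoint_eq_eigenspace_eval hnd hRsq hTR hadj hr hσ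
  have hσne : ∀ σ, T.eigenspace σ ≠ ⊥ → r.eval σ ≠ σ := by
    intro σ hσ hEq
    have e1 := hCM σ
    rw [hT'eig σ hσ, hEq, inf_idem] at e1
    exact hσ e1
  have horth : ∀ {a b : ℂ} {x y : complexBetti A.X 1}, x ∈ T.eigenspace a → y ∈ T.eigenspace b →
      polarizationPairingOne A.X h (A.dim - 1) x y ≠ 0 → a = r.eval b ∧ r.eval a = b := fun hx hy hQ ↦
    eq_eval_of_polarizationPairingOne_ne_zero hadj hr hx hy hQ
  -- `F` commutes with `T`
  have hTF : T * F = F * T := by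
    have hgen : insert T (Set.range fun ab : ι × ι ↦ U ab.1 ab.2) ⊆
        (Subalgebra.centralizer ℂ ({T} : Set (Module.End ℂ (complexBetti A.X 1))) : Set _) := by
      refine Set.insert_subset_iff.2 ⟨?_, ?_⟩
      · rw [SetLike.mem_coe, Subalgebra.mem_centralizer_iff]
        rintro _ rfl
        rfl
      · rintro _ ⟨ab, rfl⟩
        rw [SetLike.mem_coe, Subalgebra.mem_centralizer_iff]
        rintro _ rfl
        exact hUT ab.1 ab.2
    have hF' := Algebra.adjoin_le hgen hF
    rw [Subalgebra.mem_centralizer_iff] at hF'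
    exact hF' T rfl
  refine weilClassesField_le_divisorClassesSpan_of_forall_unitaryCentralizerGroup_detOnEigenspace_eq_one hPm hPe hPirr hφ
    her hh hnd fun u hu τ hτ ↦ ?_
  -- the spectral projectors `P_z`, `z ∈ s`, and the blocks `x_{z,a} = P_z E_{a i₀}^*`, `y_{z,a} = P_z E_{i₀ a}^*`
  set Pz : s → Module.End ℂ (complexBetti A.X 1) := fun z ↦ aeval T (Lagrange.basis s id (z : ℂ)) with hPzdef
  have hPzT : ∀ z : s, T * Pz z = (z : ℂ) • Pz z := fun z ↦ hTP _ z.2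
  have hPzT' : ∀ z : s, Pz z * T = T * Pz z := fun z ↦ aeval_mul_eq_mul_aeval_of_comm' rfl _
  have hPz_mem : ∀ (z : s) (v : complexBetti A.X 1), Pz z v ∈ T.eigenspace (z : ℂ) := fun z v ↦ by
    rw [Module.End.mem_eigenspace_iff, ← Module.End.mul_apply, hPzT, LinearMap.smul_apply]
  have hPzU : ∀ (z : s) a b, Pz z * U a b = U a b * Pz z := fun z a b ↦
    aeval_mul_eq_mul_aeval_of_comm' (hUT a b).symm _
  have hPzsum : ∑ z : s, Pz z = 1 := by rw [Finset.sum_coe_sort s fun z ↦ aeval T (Lagrange.basis s id z), hPsum]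
  have hPzorth : ∀ z z' : s, z ≠ z' → Pz z * Pz z' = 0 := fun z z' hzz' ↦
    hPorth _ z.2 _ z'.2 fun e1 ↦ hzz' (Subtype.ext e1)
  have hPzidem : ∀ z : s, Pz z * Pz z = Pz z := fun z ↦ hPidem _ z.2
  set xb : s → ι → Module.End ℂ (complexBetti A.X 1) := fun z a ↦ Pz z * U a i₀ with hxbdef
  set yb : s → ι → Module.End ℂ (complexBetti A.X 1) := fun z a ↦ Pz z * U i₀ a with hybdef
  set pb : s → Module.End ℂ (complexBetti A.X 1) := fun z ↦ Pz z * U i₀ i₀ with hpbdef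
  have hxy : ∀ z a b, yb z a * xb z b = if a = b then pb z else 0 := by
    intro z a b
    change Pz z * U i₀ a * (Pz z * U b i₀) = if a = b then Pz z * U i₀ i₀ else 0
    rw [mul_assoc, ← mul_assoc (U i₀ a), ← hPzU, mul_assoc, ← mul_assoc (Pz z), hPzidem, hUmul]
    split_ifs
    · rfl
    · rw [mul_zero]
  have hcross : ∀ z z', z ≠ z' → ∀ a b, yb z a * xb z' b = 0 := by
    intro z z' hzz' a b
    change Pz z * U i₀ a * (Pz z' * U b i₀) = 0
    rw [mul_assoc, ← mul_assoc (U i₀ a), ← hPzU, mul_assoc, ← mul_assoc (Pz z), hPzorth z z' hzz', zero_mul]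
  have hunit : ∀ z a b, xb z a * yb z b = Pz z * U a b := by
    intro z a b
    change Pz z * U a i₀ * (Pz z * U i₀ b) = Pz z * U a b
    rw [mul_assoc, ← mul_assoc (U a i₀), ← hPzU, mul_assoc, ← mul_assoc (Pz z), hPzidem, hUmul, if_pos rfl]
  have hsum' : ∑ z, ∑ a, xb z a * yb z a = 1 := by
    simp_rw [hunit, ← Finset.mul_sum, hUsum, mul_one]
    exact hPzsum
  -- `φ^*` lies in the span of the block units
  have hFspan : F ∈ Submodule.span ℂ (Set.range fun t : s × ι × ι ↦ xb t.1 t.2.1 * yb t.1 t.2.2) := by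
    have hUmem : ∀ a b, U a b ∈ Submodule.span ℂ (Set.range fun t : s × ι × ι ↦ xb t.1 t.2.1 * yb t.1 t.2.2) := by
      intro a b
      have e1 : U a b = ∑ z : s, xb z a * yb z b := by
        simp_rw [hunit]
        rw [← Finset.sum_mul, hPzsum, one_mul]
      rw [e1]
      exact Submodule.sum_mem _ fun z _ ↦ Submodule.subset_span ⟨(z, a, b), rfl⟩
    have hgen : insert T (Set.range fun ab : ι × ι ↦ U ab.1 ab.2) ⊆
        (Submodule.span ℂ (Set.range fun t : s × ι × ι ↦ xb t.1 t.2.1 * yb t.1 t.2.2) :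
          Set (Module.End ℂ (complexBetti A.X 1))) := by
      refine Set.insert_subset_iff.2 ⟨?_, ?_⟩
      · have e2 : T = ∑ z : s, ∑ a, (z : ℂ) • (xb z a * yb z a) := by
          simp_rw [hunit, ← Finset.smul_sum, ← Finset.mul_sum, hUsum, mul_one]
          rw [← mul_one T, ← hPzsum, Finset.mul_sum]
          exact Finset.sum_congr rfl fun z _ ↦ hPzT z
        rw [e2]
        exact Submodule.sum_mem _ fun z _ ↦ Submodule.sum_mem _ fun a _ ↦
          Submodule.smul_mem _ _ (Submodule.subset_span ⟨(z, a, a), rfl⟩)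
      · rintro _ ⟨ab, rfl⟩
        exact hUmem ab.1 ab.2
    exact adjoin_le_span_units_of_matrixBlocks hxy hcross hsum' hgen hF
  obtain ⟨cF, hcF⟩ := exists_eq_sum_smul_of_mem_span_units_blocks hFspan
  -- the corners `W_z = P_z E_{i₀i₀}^* V ⊆ ker(T - z)`
  have hW_le : ∀ z : s, LinearMap.range (pb z) ≤ T.eigenspace (z : ℂ) := by
    rintro z _ ⟨v, rfl⟩
    exact hPz_mem z _
  have hU00W : ∀ (z : s), ∀ w ∈ LinearMap.range (pb z), U i₀ i₀ w = w := by
    rintro z _ ⟨v, rfl⟩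
    change (U i₀ i₀ * (Pz z * U i₀ i₀)) v = (Pz z * U i₀ i₀) v
    rw [← mul_assoc, ← hPzU, mul_assoc, hUmul, if_pos rfl]
  have hmemW : ∀ (z : s) (v : complexBetti A.X 1), U i₀ i₀ (Pz z v) ∈ LinearMap.range (pb z) := fun z v ↦
    ⟨v, by change (Pz z * U i₀ i₀) v = _; rw [hPzU, Module.End.mul_apply]⟩
  -- an injective functional on the top line, to read `Q_h` as a scalar form
  obtain ⟨ℓ, hℓ⟩ := exists_injective_linearMap_topDegree A
  set Φ : (complexBetti A.X 1) →ₗ[ℂ] (complexBetti A.X 1) →ₗ[ℂ] ℂ :=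
    (polarizationPairingOne A.X h (A.dim - 1)).compr₂ ℓ with hΦdef
  have hΦ : ∀ v w, Φ v w = ℓ (polarizationPairingOne A.X h (A.dim - 1) v w) := fun _ _ ↦ rfl
  -- `u` commutes with `T`, the `U_{ab}`, the `P_z` and the corners
  set uE : Module.End ℂ (complexBetti A.X 1) := (u : complexBetti A.X 1 →ₗ[ℂ] complexBetti A.X 1) with huEdef
  have huE : ∀ v, uE v = u v := fun _ ↦ rfl
  have huT : uE * T = T * uE := hScomm u hu T hTe
  have huU : ∀ a b, uE * U a b = U a b * uE := fun a b ↦ hScomm u hu (U a b) (hUe a b)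
  have huPz : ∀ z, uE * Pz z = Pz z * uE := fun z ↦ (aeval_mul_eq_mul_aeval_of_comm' huT _).symm
  have hu_pb : ∀ z, uE * pb z = pb z * uE := fun z ↦ by
    change uE * (Pz z * U i₀ i₀) = Pz z * U i₀ i₀ * uE
    rw [← mul_assoc, huPz, mul_assoc, huU, mul_assoc]
  have hWu : ∀ z, ∀ v ∈ LinearMap.range (pb z), uE v ∈ LinearMap.range (pb z) := by
    rintro z _ ⟨v, rfl⟩
    exact ⟨uE v, by rw [← Module.End.mul_apply, ← hu_pb, Module.End.mul_apply]⟩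
  -- THE PERFECT PAIRING OF THE CORNERS `W_σ × W_σ̄ → ℂ`
  have hpair : ∀ (σ : s), T.eigenspace (σ : ℂ) ≠ ⊥ → ∀ (σ' : s), (σ' : ℂ) = r.eval (σ : ℂ) →
      Module.finrank ℂ ↥(LinearMap.range (pb σ)) = Module.finrank ℂ ↥(LinearMap.range (pb σ')) ∧
      LinearMap.det (uE.restrict (hWu σ)) * LinearMap.det (uE.restrict (hWu σ')) = 1 := by
    intro σ hσ σ' hσ'
    have hrr : r.eval (σ' : ℂ) = (σ : ℂ) := by rw [hσ', (hinv _ hσ).2]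
    have hv_sum : ∀ v : complexBetti A.X 1, v = ∑ z : s, Pz z v := fun v ↦ by
      conv_lhs => rw [← Module.End.one_apply (R := ℂ) (M := complexBetti A.X 1) v, ← hPzsum]
      rw [LinearMap.sum_apply]
    refine finrank_eq_and_det_mul_det_eq_one_of_pairing Φ (fun w₁ hw₁ hzero ↦ ?_) (fun w₂ hw₂ hzero ↦ ?_)
      (hWu σ) (hWu σ') fun w₁ _ w₂ _ ↦ by rw [hΦ, hΦ, huE, huE, hu.2]
    · -- left: `Q_h(w₁, ·) = 0`
      refine hnd w₁ fun v ↦ ?_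
      rw [hv_sum v, map_sum]
      refine Finset.sum_eq_zero fun z _ ↦ ?_
      by_cases hz : z = σ'
      · subst hz
        have e1 := hzero _ (hmemW z v)
        rw [hΦ, ← hUadj, hU00W σ w₁ hw₁] at e1
        exact hℓ (by rw [e1, map_zero])
      · by_contra hne
        obtain ⟨-, h2⟩ := horth (hW_le σ hw₁) (hPz_mem z v) hne
        exact hz (Subtype.ext (by rw [hσ', h2]))
    · -- right: `Q_h(·, w₂) = 0`
      refine eq_zero_of_forall_polarizationPairingOne_eq_zero_right hnd w₂ fun v ↦ ?_
      rw [hv_sum v, map_sum, LinearMap.sum_apply]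
      refine Finset.sum_eq_zero fun z _ ↦ ?_
      by_cases hz : z = σ
      · subst hz
        have e1 := hzero _ (hmemW z v)
        rw [hΦ, hUadj, hU00W σ' w₂ hw₂] at e1
        exact hℓ (by rw [e1, map_zero])
      · by_contra hne
        obtain ⟨h1, -⟩ := horth (hPz_mem z v) (hW_le σ' hw₂) hne
        exact hz (Subtype.ext (by rw [h1, hrr]))
  -- corner dimensions `k`, determinants `δ`, and their `k`-th roots `ζ`
  set k : s → ℕ := fun z ↦ Module.finrank ℂ ↥(LinearMap.range (pb z)) with hkdef
  set δ : s → ℂ := fun z ↦ LinearMap.det (uE.restrict (hWu z)) with hδdef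
  have hδunit : ∀ z, δ z ≠ 0 := fun z ↦ by
    have hU' : IsUnit (uE.restrict (hWu z)) := by
      refine (LinearMap.isUnit_iff_ker_eq_bot _).2 ?_
      rw [LinearMap.ker_eq_bot]
      intro a b hab
      have e1 := congrArg Subtype.val hab
      simp only [LinearMap.coe_restrict_apply, huE] at e1
      exact Subtype.ext (u.injective e1)
    exact (hU'.map (LinearMap.det : (↥(LinearMap.range (pb z)) →ₗ[ℂ] ↥(LinearMap.range (pb z))) →* ℂ)).ne_zero
  have hroot : ∀ z : s, ∃ ζ : ℂ, ζ ≠ 0 ∧ ζ ^ k z = δ z := fun z ↦ by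
    rcases Nat.eq_zero_or_pos (k z) with h0 | hpos
    · refine ⟨1, one_ne_zero, ?_⟩
      rw [h0, pow_zero, hδdef]
      exact (LinearMap.det_eq_one_of_finrank_eq_zero h0 _).symm
    · obtain ⟨ζ, hζ⟩ := IsAlgClosed.exists_pow_nat_eq (δ z) hpos
      exact ⟨ζ, fun h0 ↦ hδunit z (by rw [← hζ, h0, zero_pow hpos.ne']), hζ⟩
  choose ζ hζ0 hζ using hroot
  set ζ' : ℂ → ℂ := fun z ↦ if hz : z ∈ s then ζ ⟨z, hz⟩ else 1 with hζ'def
  have hζ'0 : ∀ z, ζ' z ≠ 0 := fun z ↦ by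
    simp only [hζ'def]
    split_ifs
    · exact hζ0 _
    · exact one_ne_zero
  have hζ's : ∀ z : s, ζ' z = ζ z := fun z ↦ by
    simp only [hζ'def, dif_pos z.2]
  -- one weight per conjugate pair: `σ` is CHOSEN iff `σ̄ <_lex σ`
  set chosen : ℂ → Prop := fun z ↦ (r.eval z).re < z.re ∨ ((r.eval z).re = z.re ∧ (r.eval z).im < z.im) with hchdef
  have hch : ∀ σ, T.eigenspace σ ≠ ⊥ → (chosen σ ↔ ¬ chosen (r.eval σ)) := by
    intro σ hσ
    have hrr := (hinv σ hσ).2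
    have hne := hσne σ hσ
    simp only [hchdef, hrr]
    constructor
    · rintro (h1 | ⟨h1, h2⟩) (h3 | ⟨h3, h4⟩)
      · exact lt_asymm h1 h3
      · rw [h3] at h1; exact lt_irrefl _ h1
      · rw [h1] at h3; exact lt_irrefl _ h3
      · exact lt_asymm h2 h4
    · intro hn
      push Not at hn
      obtain ⟨h1, h2⟩ := hn
      rcases lt_or_eq_of_le h1 with h3 | h3
      · exact Or.inl h3
      · right
        exact ⟨h3, lt_of_le_of_ne (h2 h3.symm) fun h4 ↦ hne (Complex.ext h3 h4)⟩
  set c : ℂ → ℂ := fun z ↦ if chosen z then ζ' z else (ζ' (r.eval z))⁻¹ with hcdef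
  have hc0 : ∀ z, c z ≠ 0 := fun z ↦ by
    simp only [hcdef]
    split_ifs
    · exact hζ'0 _
    · exact inv_ne_zero (hζ'0 _)
  have hcc : ∀ z, T.eigenspace z ≠ ⊥ → c z * c (r.eval z) = 1 := by
    intro z hz
    have hrr := (hinv z hz).2
    by_cases h1 : chosen z
    · have h2 : ¬ chosen (r.eval z) := (hch z hz).1 h1
      simp only [hcdef, if_pos h1, if_neg h2, hrr, mul_inv_cancel₀ (hζ'0 z)]
    · have h2 : chosen (r.eval z) := by
        by_contra h2
        exact h1 ((hch z hz).2 h2)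
      simp only [hcdef, if_neg h1, if_pos h2, inv_mul_cancel₀ (hζ'0 _)]
  -- the diagonal operator `t = Σ c_z P_z` and `u₁ = t⁻¹ u`
  obtain ⟨t, htact, htcomm⟩ := exists_linearEquiv_apply_eq_smul hRsq hTR (c := c) fun z _ ↦ hc0 z
  have htsymm : ∀ S : Module.End ℂ (complexBetti A.X 1), S * T = T * S → ∀ x, t.symm (S x) = S (t.symm x) := by
    intro S hS x
    apply t.injective
    rw [t.apply_symm_apply, htcomm S hS, t.apply_symm_apply]
  have htsymm_act : ∀ (z : ℂ), ∀ x ∈ T.eigenspace z, t.symm x = (c z)⁻¹ • x := by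
    intro z x hx
    apply t.injective
    rw [t.apply_symm_apply, map_smul, htact z x hx, smul_smul, inv_mul_cancel₀ (hc0 z), one_smul]
  have hFT : F * T = T * F := hTF.symm
  set u₁ : complexBetti A.X 1 ≃ₗ[ℂ] complexBetti A.X 1 := t⁻¹ * u with hu₁def
  have hu₁app : ∀ x, u₁ x = t.symm (u x) := fun _ ↦ rfl
  set u₁E : Module.End ℂ (complexBetti A.X 1) := (u₁ : complexBetti A.X 1 →ₗ[ℂ] complexBetti A.X 1) with hu₁Edef
  have hu₁E : ∀ v, u₁E v = t.symm (u v) := fun _ ↦ rfl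
  have huTx : ∀ x, u (T x) = T (u x) := fun x ↦ by
    have e1 := LinearMap.congr_fun huT x
    rwa [Module.End.mul_apply, Module.End.mul_apply, huE, huE] at e1
  have huUx : ∀ a b x, u (U a b x) = U a b (u x) := fun a b x ↦ by
    have e1 := LinearMap.congr_fun (huU a b) x
    rwa [Module.End.mul_apply, Module.End.mul_apply, huE, huE] at e1
  have hu₁F : ∀ x, u₁ (F x) = F (u₁ x) := fun x ↦ by rw [hu₁app, hu₁app, hu.1 φ x, htsymm F hFT]
  have hu₁U : ∀ a b x, u₁E (U a b x) = U a b (u₁E x) := fun a b x ↦ by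
    rw [hu₁E, hu₁E, huUx a b x, htsymm (U a b) (hUT a b).symm]
  have hu₁Pz : ∀ z x, u₁E (Pz z x) = Pz z (u₁E x) := fun z x ↦ by
    rw [hu₁E, hu₁E, ← huE, ← Module.End.mul_apply, huPz, Module.End.mul_apply, huE, htsymm (Pz z) (hPzT' z)]
  have hux : ∀ z a, u₁E * xb z a = xb z a * u₁E := fun z a ↦ LinearMap.ext fun x ↦ by
    change u₁E ((Pz z * U a i₀) x) = (Pz z * U a i₀) (u₁E x)
    rw [Module.End.mul_apply, Module.End.mul_apply, hu₁Pz, hu₁U]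
  have hu₁_pb : ∀ z x, u₁E (pb z x) = pb z (u₁E x) := fun z x ↦ by
    change u₁E ((Pz z * U i₀ i₀) x) = (Pz z * U i₀ i₀) (u₁E x)
    rw [Module.End.mul_apply, Module.End.mul_apply, hu₁Pz, hu₁U]
  have hWu₁ : ∀ z, Set.MapsTo u₁E (LinearMap.range (pb z)) (LinearMap.range (pb z)) := by
    rintro z _ ⟨v, rfl⟩
    exact ⟨u₁E v, (hu₁_pb z v).symm⟩
  have hVu₁ : Set.MapsTo u₁E (F.eigenspace τ) (F.eigenspace τ) := mapsTo_eigenspace_of_comm hu₁F τ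
  -- `t⁻¹` on the corner `W_z` is the scalar `c(z)⁻¹`
  have hWt : ∀ z, ∀ v ∈ LinearMap.range (pb z), (t.symm : complexBetti A.X 1 →ₗ[ℂ] complexBetti A.X 1) v ∈
      LinearMap.range (pb z) := by
    intro z v hv
    rw [LinearEquiv.coe_coe, htsymm_act (z : ℂ) v (hW_le z hv)]
    exact Submodule.smul_mem _ _ hv
  have hdet_t : ∀ z, LinearMap.det ((t.symm : complexBetti A.X 1 →ₗ[ℂ] complexBetti A.X 1).restrict (hWt z)) =
      (c z)⁻¹ ^ k z := by
    intro z
    have e1 : (t.symm : complexBetti A.X 1 →ₗ[ℂ] complexBetti A.X 1).restrict (hWt z) = (c (z : ℂ))⁻¹ • LinearMap.id := by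
      refine LinearMap.ext fun w ↦ Subtype.ext ?_
      rw [LinearMap.coe_restrict_apply, LinearMap.smul_apply, LinearMap.id_apply, Submodule.coe_smul, LinearEquiv.coe_coe]
      exact htsymm_act (z : ℂ) w (hW_le z w.2)
    rw [e1, LinearMap.det_smul, LinearMap.det_id, mul_one]
  -- `det(u₁ | W_z) = 1` for every corner
  have hcorner : ∀ z, LinearMap.det (u₁E.restrict (hWu₁ z)) = 1 := by
    intro z
    have hsplit : u₁E.restrict (hWu₁ z) =
        (t.symm : complexBetti A.X 1 →ₗ[ℂ] complexBetti A.X 1).restrict (hWt z) ∘ₗ uE.restrict (hWu z) :=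
      LinearMap.ext fun w ↦ Subtype.ext rfl
    rw [hsplit, LinearMap.det_comp, hdet_t]
    change (c (z : ℂ))⁻¹ ^ k z * δ z = 1
    rcases Nat.eq_zero_or_pos (k z) with h0 | hpos
    · rw [h0, pow_zero, one_mul, hδdef]
      exact LinearMap.det_eq_one_of_finrank_eq_zero h0 _
    · -- `W_z ≠ 0`, so `z` is spectral
      have hz : T.eigenspace (z : ℂ) ≠ ⊥ := by
        intro hbot
        have hle := hW_le z
        rw [hbot, le_bot_iff] at hle
        have hk0 : k z = 0 := by
          change Module.finrank ℂ ↥(LinearMap.range (pb z)) = 0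
          rw [hle, finrank_bot]
        exact hpos.ne' hk0
      have hz's : r.eval (z : ℂ) ∈ s := hmem_s (hinv _ hz).1
      by_cases h1 : chosen (z : ℂ)
      · have hcz : c z = ζ z := by simp only [hcdef, if_pos h1, hζ's]
        rw [hcz, ← hζ z, ← mul_pow, inv_mul_cancel₀ (hζ0 z), one_pow]
      · set z' : s := ⟨r.eval (z : ℂ), hz's⟩ with hz'def
        have hcz : c z = (ζ z')⁻¹ := by
          simp only [hcdef, if_neg h1]
          rw [hζ's z']
        obtain ⟨hk, hδδ⟩ := hpair z hz z' rfl
        rw [hcz, inv_inv, show k z = k z' from hk, hζ z', mul_comm]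
        exact hδδ
  -- `det(u₁ | V_τ) = ∏_z det(u₁ | W_z)^{l_z} = 1`
  obtain ⟨l, hl⟩ := exists_det_restrict_eigenspace_eq_prod_pow hxy hcross hsum' cF hcF hux τ hVu₁ hWu₁
  have hdet₁ : detOnEigenspace u₁ F hu₁F τ = 1 := by
    unfold detOnEigenspace
    rw [show LinearMap.det ((u₁ : complexBetti A.X 1 →ₗ[ℂ] complexBetti A.X 1).restrict (mapsTo_eigenspace_of_comm hu₁F τ))
      = LinearMap.det (u₁E.restrict hVu₁) from rfl, hl]
    exact Finset.prod_eq_one fun z _ ↦ by rw [hcorner, one_pow]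
  -- `det(u | V_τ) = det(t | V_τ) · det(u₁ | V_τ) = det(t | V_τ) = ∏ c(z)^{dim(V_τ ∩ ker(T - z))}`
  have htF : ∀ x, t (F x) = F (t x) := htcomm F hFT
  have hut : u = t * u₁ := by rw [hu₁def, mul_inv_cancel_left]
  have htu₁F : ∀ x, (t * u₁) (F x) = F ((t * u₁) x) := fun x ↦ by rw [← hut]; exact hu.1 φ x
  rw [detOnEigenspace_congr hut (hu.1 φ) htu₁F, detOnEigenspace_mul htF hu₁F htu₁F, hdet₁, mul_one,
    detOnEigenspace_eq_prod_pow_finrank hRsq hTR htact htF hTF τ]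
  -- `= 1` by the balance, pairing `z ↔ z̄`
  set n : ℂ → ℕ := fun z ↦ Module.finrank ℂ ↥(F.eigenspace τ ⊓ T.eigenspace z) with hndef
  have hn0 : ∀ z, T.eigenspace z = ⊥ → n z = 0 := fun z hz ↦ by
    change Module.finrank ℂ ↥(F.eigenspace τ ⊓ T.eigenspace z) = 0
    rw [hz, inf_bot_eq, finrank_bot]
  have hnr : ∀ z, T.eigenspace z ≠ ⊥ → n (r.eval z) = n z := fun z hz ↦ by
    change Module.finrank ℂ ↥(F.eigenspace τ ⊓ T.eigenspace (r.eval z)) = Module.finrank ℂ ↥(F.eigenspace τ ⊓ T.eigenspace z)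
    rw [← hT'eig z hz]
    exact (hbal τ hτ z).symm
  set g : ∀ z ∈ s, ℂ := fun z _ ↦ if T.eigenspace z = ⊥ then z else r.eval z with hgdef
  have hg_bot : ∀ z (hz : z ∈ s), T.eigenspace z = ⊥ → g z hz = z := fun z hz hb ↦ by
    change (if T.eigenspace z = ⊥ then z else r.eval z) = z
    rw [if_pos hb]
  have hg_ne : ∀ z (hz : z ∈ s), T.eigenspace z ≠ ⊥ → g z hz = r.eval z := fun z hz hb ↦ by
    change (if T.eigenspace z = ⊥ then z else r.eval z) = r.eval z
    rw [if_neg hb]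
  change ∏ z ∈ s, c z ^ n z = 1
  refine Finset.prod_involution g (fun z hz ↦ ?_) (fun z hz ↦ ?_) (fun z hz ↦ ?_) (fun z hz ↦ ?_)
  · by_cases hbot : T.eigenspace z = ⊥
    · rw [hg_bot z hz hbot, hn0 z hbot, pow_zero, mul_one]
    · rw [hg_ne z hz hbot, hnr z hbot, ← mul_pow, hcc z hbot, one_pow]
  · intro hf1
    by_cases hbot : T.eigenspace z = ⊥
    · exact absurd (by rw [hn0 z hbot, pow_zero]) hf1
    · rw [hg_ne z hz hbot]
      exact hσne z hbot
  · by_cases hbot : T.eigenspace z = ⊥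
    · rw [hg_bot z hz hbot]; exact hz
    · rw [hg_ne z hz hbot]; exact hmem_s (hinv z hbot).1
  · by_cases hbot : T.eigenspace z = ⊥
    · have e1 : g z hz = z := hg_bot z hz hbot
      have e2 : g z hz ∈ s := by rw [e1]; exact hz
      rw [hg_bot _ e2 (by rw [e1]; exact hbot), e1]
    · have e1 : g z hz = r.eval z := hg_ne z hz hbot
      have e2 : g z hz ∈ s := by rw [e1]; exact hmem_s (hinv z hbot).1
      rw [hg_ne _ e2 (by rw [e1]; exact (hinv z hbot).1), e1, (hinv z hbot).2]

/-- **… hence HODGE and ALGEBRAIC**: under the hypotheses of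
`weilClassesField_le_divisorClassesSpan_of_matrixUnits_of_forall_finrank_eq`, `W_F ⊗ ℂ ≤ algebraicClasses A.X m`
(Lefschetz `(1,1)`, the tree's `lefschetzOneOne_rational_holds`). [cite: MoonenZarhin1998WeilClasses, Introduction (chunk p0001 L10–L18) and §1 Criterion (2) (chunk p0003 L46–L80)]
[cite: VoisinHodgeI2002, Thm. 11.30] -/
theorem weilClassesField_le_algebraicClasses_of_matrixUnits_of_forall_finrank_eq (hPm : P.Monic) (hPe : P.natDegree = e)
    (hPirr : Irreducible (P.map (Int.castRingHom ℚ)))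
    (hφ : Polynomial.eval₂ (Int.castRingHom (CategoryTheory.End A)) (φ : CategoryTheory.End A) P = 0)
    (her : e * (2 * m) = 2 * A.dim) (hh : h ∈ hodgeClassSpan A.dim A.X 1)
    (hnd : ∀ x : complexBetti A.X 1, (∀ y, polarizationPairingOne A.X h (A.dim - 1) x y = 0) → x = 0)
    (hTe : T ∈ Algebra.adjoin ℂ (Set.range fun χ : A ⟶ A ↦ pullbackOne A χ))
    (hRm : R.Monic) (hRirr : Irreducible (R.map (Int.castRingHom ℚ))) (hTR : aeval T (R.map (Int.castRingHom ℂ)) = 0)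
    (hT' : T' ∈ Algebra.adjoin ℂ ({T} : Set (Module.End ℂ (complexBetti A.X 1))))
    (hadj : ∀ x y : complexBetti A.X 1, polarizationPairingOne A.X h (A.dim - 1) (T x) y =
      polarizationPairingOne A.X h (A.dim - 1) x (T' y))
    (hCM : ∀ σ : ℂ, T.eigenspace σ ⊓ T'.eigenspace σ = ⊥) (i₀ : ι)
    (hUe : ∀ a b, U a b ∈ Algebra.adjoin ℂ (Set.range fun χ : A ⟶ A ↦ pullbackOne A χ))
    (hUmul : ∀ a b c d, U a b * U c d = if b = c then U a d else 0) (hUsum : ∑ a, U a a = 1)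
    (hUadj : ∀ a b (x y : complexBetti A.X 1), polarizationPairingOne A.X h (A.dim - 1) (U a b x) y =
      polarizationPairingOne A.X h (A.dim - 1) x (U b a y))
    (hUT : ∀ a b, T * U a b = U a b * T)
    (hF : pullbackOne A φ ∈ Algebra.adjoin ℂ (insert T (Set.range fun ab : ι × ι ↦ U ab.1 ab.2)))
    (hbal : ∀ ρ : ℂ, Polynomial.eval₂ (Int.castRingHom ℂ) ρ P = 0 → ∀ σ : ℂ,
      Module.finrank ℂ ↥((pullbackOne A φ).eigenspace ρ ⊓ T.eigenspace σ) =
        Module.finrank ℂ ↥((pullbackOne A φ).eigenspace ρ ⊓ T'.eigenspace σ)) :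
    weilClassesField A φ P (2 * m) ≤ algebraicClasses A.X m :=
  (weilClassesField_le_divisorClassesSpan_of_matrixUnits_of_forall_finrank_eq hPm hPe hPirr hφ her hh hnd hTe hRm hRirr hTR
    hT' hadj hCM i₀ hUe hUmul hUsum hUadj hUT hF hbal).trans
    (AbelianVariety.divisorClassesSpan_le_algebraicClasses A
      (fun b hb hb' ↦ lefschetzOneOne_rational_holds (AbelianVariety.isSmoothProjective_holds (A := A)) b hb hb') m)

end Mechanism

end CentralTorus

open CentralTorus

/-! ### §3 `m = 1`: `F ⊆ E` on `A` itself -/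

section Subfield

variable {A : AbelianVariety ℂ} {h : complexBetti A.X 2} {φ ψ ψ' : A ⟶ A} {P R : Polynomial ℤ} {e m : ℕ}

/-- **CRITERION (2), TYPE 4 WITH `d = 1`, `m = 1` — THE DECOMPOSABLE HALF, ON THE CARRIER.** Let `ψ ∈ End(A)` have
minimal polynomial `R ∈ ℤ[T]` (monic, irreducible over `ℚ`; `E = ℚ(ψ)`), with ROSATI IMAGE `ψ' ∈ End(A)`
(`Q_h(ψ^* x, y) = Q_h(x, ψ'^* y)`, `ψ'^* ∈ ℂ[ψ^*]`: «`ψ† ∈ E`») and NO REAL PLACE on `H¹`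
(`ker(ψ^* - σ) ∩ ker(ψ'^* - σ) = 0` for every `σ`: `E` totally imaginary with `†` = complex conjugation — the CM centre of
a type-4 algebra), and let `F = ℚ(φ) ⊆ E` (`φ^* ∈ ℂ[ψ^*]`, `P(φ) = 0`, `deg P · 2m = 2 dim A`; `h ∈ B¹ ⊗ ℂ`, `Q_h`
non-degenerate). If the multiplicities are balanced — `dim(V_ρ ∩ ker(ψ^* - σ)) = dim(V_ρ ∩ ker(ψ'^* - σ))` for all
roots `ρ` of `P` and all `σ` — then `W_F ⊗ ℂ ≤ 𝒟ᵐ ⊗ ℂ`. With the seat's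
`weilClassesField_inf_divisorClassesSpan_eq_bot_of_central_of_finrank_ne` (imbalance ⟹ exceptional, for `ψ` central)
this is the print's dichotomy «Type 4, `d = 1`, `m = 1`: decomposable iff `F ⊆ E₀`» in its intrinsic form `θ = 0`
(for `F ⊆ E₀` the multiplicities are balanced since `φ` is then Rosati-symmetric; the tree's `…OfSymmetric` row).
[cite: MoonenZarhin1998WeilClasses, §1 Criterion (2), cases «Type 4, d = 1, m = 1» and «Type 4 with d ≥ 2 or m ≥ 2», with its proof (chunk p0003 L46–L80)]
[cite: Milne1999LefschetzClasses, §1 pp. 642–644, Thm. 3.2, Cor. 4.5] -/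
theorem weilClassesField_le_divisorClassesSpan_of_mem_adjoin_of_forall_finrank_eq (hPm : P.Monic) (hPe : P.natDegree = e)
    (hPirr : Irreducible (P.map (Int.castRingHom ℚ)))
    (hφ : Polynomial.eval₂ (Int.castRingHom (CategoryTheory.End A)) (φ : CategoryTheory.End A) P = 0)
    (her : e * (2 * m) = 2 * A.dim) (hh : h ∈ hodgeClassSpan A.dim A.X 1)
    (hnd : ∀ x : complexBetti A.X 1, (∀ y, polarizationPairingOne A.X h (A.dim - 1) x y = 0) → x = 0)
    (hRm : R.Monic) (hRirr : Irreducible (R.map (Int.castRingHom ℚ)))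
    (hψR : Polynomial.eval₂ (Int.castRingHom (CategoryTheory.End A)) (ψ : CategoryTheory.End A) R = 0)
    (hψ' : pullbackOne A ψ' ∈ Algebra.adjoin ℂ ({pullbackOne A ψ} : Set (Module.End ℂ (complexBetti A.X 1))))
    (hadj : ∀ x y : complexBetti A.X 1, polarizationPairingOne A.X h (A.dim - 1) (pullbackOne A ψ x) y =
      polarizationPairingOne A.X h (A.dim - 1) x (pullbackOne A ψ' y))
    (hCM : ∀ σ : ℂ, (pullbackOne A ψ).eigenspace σ ⊓ (pullbackOne A ψ').eigenspace σ = ⊥)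
    (hF : pullbackOne A φ ∈ Algebra.adjoin ℂ ({pullbackOne A ψ} : Set (Module.End ℂ (complexBetti A.X 1))))
    (hbal : ∀ ρ : ℂ, Polynomial.eval₂ (Int.castRingHom ℂ) ρ P = 0 → ∀ σ : ℂ,
      Module.finrank ℂ ↥((pullbackOne A φ).eigenspace ρ ⊓ (pullbackOne A ψ).eigenspace σ) =
        Module.finrank ℂ ↥((pullbackOne A φ).eigenspace ρ ⊓ (pullbackOne A ψ').eigenspace σ)) :
    weilClassesField A φ P (2 * m) ≤ divisorClassesSpan A.X A.dim m := by
  refine weilClassesField_le_divisorClassesSpan_of_matrixUnits_of_forall_finrank_eq (ι := Unit)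
    (U := fun _ _ ↦ (1 : Module.End ℂ (complexBetti A.X 1))) hPm hPe hPirr hφ her hh hnd (Algebra.subset_adjoin ⟨ψ, rfl⟩)
    hRm hRirr (aeval_hom_complexBetti_map_one_eq_zero hψR) hψ' hadj hCM () (fun _ _ ↦ Subalgebra.one_mem _)
    (fun _ _ _ _ ↦ by rw [mul_one, if_pos rfl]) (Fintype.sum_unique _) (fun _ _ _ _ ↦ rfl)
    (fun _ _ ↦ by rw [mul_one, one_mul]) (Algebra.adjoin_mono (Set.singleton_subset_iff.2 (Set.mem_insert _ _)) hF) hbal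

/-- **… hence ALGEBRAIC** (`W_F ⊗ ℂ ≤ algebraicClasses A.X m`). [cite: MoonenZarhin1998WeilClasses, Introduction (chunk p0001 L10–L18) and §1 Criterion (2) (chunk p0003 L46–L80)]
[cite: VoisinHodgeI2002, Thm. 11.30] -/
theorem weilClassesField_le_algebraicClasses_of_mem_adjoin_of_forall_finrank_eq (hPm : P.Monic) (hPe : P.natDegree = e)
    (hPirr : Irreducible (P.map (Int.castRingHom ℚ)))
    (hφ : Polynomial.eval₂ (Int.castRingHom (CategoryTheory.End A)) (φ : CategoryTheory.End A) P = 0)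
    (her : e * (2 * m) = 2 * A.dim) (hh : h ∈ hodgeClassSpan A.dim A.X 1)
    (hnd : ∀ x : complexBetti A.X 1, (∀ y, polarizationPairingOne A.X h (A.dim - 1) x y = 0) → x = 0)
    (hRm : R.Monic) (hRirr : Irreducible (R.map (Int.castRingHom ℚ)))
    (hψR : Polynomial.eval₂ (Int.castRingHom (CategoryTheory.End A)) (ψ : CategoryTheory.End A) R = 0)
    (hψ' : pullbackOne A ψ' ∈ Algebra.adjoin ℂ ({pullbackOne A ψ} : Set (Module.End ℂ (complexBetti A.X 1))))
    (hadj : ∀ x y : complexBetti A.X 1, polarizationPairingOne A.X h (A.dim - 1) (pullbackOne A ψ x) y =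
      polarizationPairingOne A.X h (A.dim - 1) x (pullbackOne A ψ' y))
    (hCM : ∀ σ : ℂ, (pullbackOne A ψ).eigenspace σ ⊓ (pullbackOne A ψ').eigenspace σ = ⊥)
    (hF : pullbackOne A φ ∈ Algebra.adjoin ℂ ({pullbackOne A ψ} : Set (Module.End ℂ (complexBetti A.X 1))))
    (hbal : ∀ ρ : ℂ, Polynomial.eval₂ (Int.castRingHom ℂ) ρ P = 0 → ∀ σ : ℂ,
      Module.finrank ℂ ↥((pullbackOne A φ).eigenspace ρ ⊓ (pullbackOne A ψ).eigenspace σ) =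
        Module.finrank ℂ ↥((pullbackOne A φ).eigenspace ρ ⊓ (pullbackOne A ψ').eigenspace σ)) :
    weilClassesField A φ P (2 * m) ≤ algebraicClasses A.X m :=
  (weilClassesField_le_divisorClassesSpan_of_mem_adjoin_of_forall_finrank_eq hPm hPe hPirr hφ her hh hnd hRm hRirr hψR
    hψ' hadj hCM hF hbal).trans
    (AbelianVariety.divisorClassesSpan_le_algebraicClasses A
      (fun b hb hb' ↦ lefschetzOneOne_rational_holds (AbelianVariety.isSmoothProjective_holds (A := A)) b hb hb') m)

end Subfield

/-! ### §4 Powers `X = A^{n+1}`: `F ⊆ M_{n+1}(E)` with the product polarization -/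

section Powers

variable {A : AbelianVariety ℂ} {h : complexBetti A.X 2} {n : ℕ} {ψ ψ' : A ⟶ A}
  {φ : ⨁ (fun _ : Fin (n + 1) => A) ⟶ ⨁ (fun _ : Fin (n + 1) => A)} {P R : Polynomial ℤ} {e m : ℕ}

/-- `ιᵢ^* (⊕g)^* = gᵢ^* ιᵢ^*` on `H¹` (`ιᵢ ≫ ⊕g = gᵢ ≫ ιᵢ`). [cite: LangeBirkenhake1992, §1.1] -/
theorem map_ι_pullbackOne_biproductMap (g : Fin (n + 1) → (A ⟶ A)) (i : Fin (n + 1))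
    (x : complexBetti (⨁ (fun _ : Fin (n + 1) => A)).X 1) :
    complexBetti.map (biproduct.ι (fun _ : Fin (n + 1) => A) i).hom.hom.hom 1
        (pullbackOne (⨁ (fun _ : Fin (n + 1) => A)) (biproduct.map g) x) =
      pullbackOne A (g i) (complexBetti.map (biproduct.ι (fun _ : Fin (n + 1) => A) i).hom.hom.hom 1 x) := by
  change (complexBetti.map (biproduct.map g).hom.hom.hom 1 ≫
      complexBetti.map (biproduct.ι (fun _ : Fin (n + 1) => A) i).hom.hom.hom 1) x =
    (complexBetti.map (biproduct.ι (fun _ : Fin (n + 1) => A) i).hom.hom.hom 1 ≫ complexBetti.map (g i).hom.hom.hom 1) x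
  rw [← complexBetti.map_comp, ← complexBetti.map_comp]
  change (complexBetti.map (biproduct.ι (fun _ : Fin (n + 1) => A) i ≫ biproduct.map g).hom.hom.hom 1) x =
    (complexBetti.map (g i ≫ biproduct.ι (fun _ : Fin (n + 1) => A) i).hom.hom.hom 1) x
  rw [biproduct.ι_map]

/-- **No real place survives on the power**: if `ker(ψ^* - σ) ∩ ker(ψ'^* - σ) = 0` on `H¹(A)` for every `σ`, then
`ker((⊕ψ)^* - σ) ∩ ker((⊕ψ')^* - σ) = 0` on `H¹(A^{n+1}) = ⊕ πᵢ^* H¹(A)` (slot by slot). [cite: Milne1999LefschetzClasses, §1 p. 643 («V(A^r) = rV(A)»)] -/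
theorem eigenspace_biproductMap_inf_eq_bot
    (hCM : ∀ σ : ℂ, (pullbackOne A ψ).eigenspace σ ⊓ (pullbackOne A ψ').eigenspace σ = ⊥) (σ : ℂ) :
    (pullbackOne (⨁ (fun _ : Fin (n + 1) => A)) (biproduct.map fun _ : Fin (n + 1) => ψ)).eigenspace σ ⊓
      (pullbackOne (⨁ (fun _ : Fin (n + 1) => A)) (biproduct.map fun _ : Fin (n + 1) => ψ')).eigenspace σ = ⊥ := by
  rw [Submodule.eq_bot_iff]
  rintro x ⟨hx, hx'⟩
  rw [SetLike.mem_coe, Module.End.mem_eigenspace_iff] at hx hx'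
  have hslot : ∀ i, complexBetti.map (biproduct.ι (fun _ : Fin (n + 1) => A) i).hom.hom.hom 1 x = 0 := by
    intro i
    have h0 := hCM σ
    rw [Submodule.eq_bot_iff] at h0
    have e1 := map_ι_pullbackOne_biproductMap (fun _ : Fin (n + 1) ↦ ψ) i x
    have e2 := map_ι_pullbackOne_biproductMap (fun _ : Fin (n + 1) ↦ ψ') i x
    rw [hx, map_smul] at e1
    rw [hx', map_smul] at e2
    refine h0 _ ⟨?_, ?_⟩ <;> rw [SetLike.mem_coe, Module.End.mem_eigenspace_iff]
    · exact e1.symm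
    · exact e2.symm
  rw [← sum_map_π_map_ι (fun _ : Fin (n + 1) => A) x]
  exact Finset.sum_eq_zero fun i _ ↦ by rw [hslot, map_zero]

/-- **CRITERION (2), TYPE 4 WITH `d = 1`, POWERS — THE DECOMPOSABLE HALF ON THE CARRIER: «`θ = 0` ⟹ `W_F` consists of
decomposable classes» for `X = A^{n+1}` and `F ⊆ M_{n+1}(E)`.** Let `A` be a complex abelian variety of positive dimension
with `h ∈ B¹ ⊗ ℂ`, `h^{dim A} ≠ 0`, `Q_h` non-degenerate; `ψ ∈ End(A)` with minimal polynomial `R ∈ ℤ[T]` monic irreducible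
over `ℚ` (`E = ℚ(ψ)`), Rosati image `ψ' ∈ End(A)` (`Q_h(ψ^* x, y) = Q_h(x, ψ'^* y)`, `ψ'^* ∈ ℂ[ψ^*]`) and no real place
(`ker(ψ^* - σ) ∩ ker(ψ'^* - σ) = 0`); let `X = A^{n+1}` carry the product polarization `Σ πᵢ^* h` and let `φ ∈ End(X)`
have matrix entries `ιₐ ≫ φ ≫ π_b = p_{ab}(ψ)` («`F = ℚ(φ) ⊆ M_{n+1}(E)`»), `P(φ) = 0`, `P` monic irreducible of degree `e`,
`e · 2m = 2(n+1) dim A`. If for every root `ρ` of `P` and every `σ` the multiplicities of `σ` for `(⊕ψ)^*` and `(⊕ψ')^*`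
on `V_ρ = ker(φ^* - ρ) ⊆ H¹(X)` agree, then `W_F(X) ⊗ ℂ ≤ 𝒟ᵐ(X) ⊗ ℂ`. Together with the seat's
`weilClassesField_biproduct_inf_divisorClassesSpan_eq_bot_of_central_of_finrank_ne` (imbalance ⟹ exceptional, `ψ`
central) this is, on the carrier, the print's «`X ∼ Y^m`, `Y` of type 4 with `d = 1` (`End⁰(Y) = E` a CM field),
`m ≥ 2`: `W_F` decomposable ⟺ `θ = 0`» — by the torus normalisation and the Morita corners `P_σ (π₀ ≫ ι₀)^* H¹(X)`,
with no connectedness argument. [cite: MoonenZarhin1998WeilClasses, §1 Criterion (2), case «Type 4 with d ≥ 2 or m ≥ 2» and its proof (chunk p0003 L46–L80); Table 1 (B = End⁰(X) for type 4)]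
[cite: Milne1999LefschetzClasses, §1 p. 643, Thm. 3.2, Cor. 4.5] [cite: McconnellRobson2001, 3.5.5–3.5.7] -/
theorem weilClassesField_biproduct_le_divisorClassesSpan_of_entry_eq_eval₂_of_forall_finrank_eq (hA : 0 < A.dim)
    (hh : h ∈ hodgeClassSpan A.dim A.X 1) (htop : lefschetzPow h (A.dim - 1) 2 h ≠ 0)
    (hnd : ∀ x : complexBetti A.X 1, (∀ y, polarizationPairingOne A.X h (A.dim - 1) x y = 0) → x = 0)
    (hRm : R.Monic) (hRirr : Irreducible (R.map (Int.castRingHom ℚ)))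
    (hψR : Polynomial.eval₂ (Int.castRingHom (CategoryTheory.End A)) (ψ : CategoryTheory.End A) R = 0)
    (hψ' : pullbackOne A ψ' ∈ Algebra.adjoin ℂ ({pullbackOne A ψ} : Set (Module.End ℂ (complexBetti A.X 1))))
    (hadj : ∀ x y : complexBetti A.X 1, polarizationPairingOne A.X h (A.dim - 1) (pullbackOne A ψ x) y =
      polarizationPairingOne A.X h (A.dim - 1) x (pullbackOne A ψ' y))
    (hCM : ∀ σ : ℂ, (pullbackOne A ψ).eigenspace σ ⊓ (pullbackOne A ψ').eigenspace σ = ⊥)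
    (hPm : P.Monic) (hPe : P.natDegree = e) (hPirr : Irreducible (P.map (Int.castRingHom ℚ)))
    (hφ : Polynomial.eval₂ (Int.castRingHom (CategoryTheory.End (⨁ (fun _ : Fin (n + 1) => A))))
      (φ : CategoryTheory.End (⨁ (fun _ : Fin (n + 1) => A))) P = 0)
    (her : e * (2 * m) = 2 * ((n + 1) * A.dim)) (p : Fin (n + 1) → Fin (n + 1) → Polynomial ℤ)
    (hφp : ∀ a b, biproduct.ι (fun _ : Fin (n + 1) => A) a ≫ φ ≫ biproduct.π (fun _ : Fin (n + 1) => A) b =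
      Polynomial.eval₂ (Int.castRingHom (CategoryTheory.End A)) (ψ : CategoryTheory.End A) (p a b))
    (hbal : ∀ ρ : ℂ, Polynomial.eval₂ (Int.castRingHom ℂ) ρ P = 0 → ∀ σ : ℂ,
      Module.finrank ℂ ↥((pullbackOne (⨁ (fun _ : Fin (n + 1) => A)) φ).eigenspace ρ ⊓
        (pullbackOne (⨁ (fun _ : Fin (n + 1) => A)) (biproduct.map fun _ : Fin (n + 1) => ψ)).eigenspace σ) =
      Module.finrank ℂ ↥((pullbackOne (⨁ (fun _ : Fin (n + 1) => A)) φ).eigenspace ρ ⊓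
        (pullbackOne (⨁ (fun _ : Fin (n + 1) => A)) (biproduct.map fun _ : Fin (n + 1) => ψ')).eigenspace σ)) :
    weilClassesField (⨁ (fun _ : Fin (n + 1) => A)) φ P (2 * m) ≤
      divisorClassesSpan (⨁ (fun _ : Fin (n + 1) => A)).X (⨁ (fun _ : Fin (n + 1) => A)).dim m := by
  obtain ⟨hhX, -, hndX⟩ := sumPolarizationClass_hypotheses (fun _ : Fin (n + 1) => A) (fun _ => h)
      (fun _ => hA) (fun _ => hh) (fun _ => htop) (fun _ => hnd)
  have herX : e * (2 * m) = 2 * (⨁ (fun _ : Fin (n + 1) => A)).dim := by rw [dim_biproduct_const_succ A n, her]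
  exact weilClassesField_le_divisorClassesSpan_of_matrixUnits_of_forall_finrank_eq
    (U := fun a b ↦ pullbackOne (⨁ (fun _ : Fin (n + 1) => A))
      (biproduct.π (fun _ : Fin (n + 1) => A) a ≫ biproduct.ι (fun _ : Fin (n + 1) => A) b))
    hPm hPe hPirr hφ herX hhX hndX (Algebra.subset_adjoin ⟨_, rfl⟩) hRm hRirr
    (aeval_pullbackOne_biproductMap_const_eq_zero hψR) (pullbackOne_biproductMap_const_mem_adjoin_of_mem_adjoin hψ')
    (fun x y ↦ polarizationPairingOne_biproductMap_of_adjoint (fun _ : Fin (n + 1) => A) (fun _ => h) (fun _ => hA)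
      (fun _ => ψ) (fun _ => ψ') (fun _ => hadj) x y)
    (eigenspace_biproductMap_inf_eq_bot hCM) (0 : Fin (n + 1)) (fun a b ↦ Algebra.subset_adjoin ⟨_, rfl⟩)
    (fun a b c d ↦ pullbackOne_π_comp_ι_mul a b c d) sum_pullbackOne_π_comp_ι
    (fun a b v w ↦ polarizationPairingOne_pullbackOne_π_comp_ι hA hh htop hnd a b v w)
    (fun a b ↦ pullbackOne_biproductMap_const_mul_π_comp_ι ψ a b) (pullbackOne_mem_adjoin_diagonal_of_entry_eq_eval₂ p hφp)
    hbal

/-- **… hence ALGEBRAIC**: `W_F(A^{n+1}) ⊗ ℂ ≤ algebraicClasses`. [cite: MoonenZarhin1998WeilClasses, Introduction (chunk p0001 L10–L18) and §1 Criterion (2) (chunk p0003 L46–L80)]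
[cite: VoisinHodgeI2002, Thm. 11.30] -/
theorem weilClassesField_biproduct_le_algebraicClasses_of_entry_eq_eval₂_of_forall_finrank_eq (hA : 0 < A.dim)
    (hh : h ∈ hodgeClassSpan A.dim A.X 1) (htop : lefschetzPow h (A.dim - 1) 2 h ≠ 0)
    (hnd : ∀ x : complexBetti A.X 1, (∀ y, polarizationPairingOne A.X h (A.dim - 1) x y = 0) → x = 0)
    (hRm : R.Monic) (hRirr : Irreducible (R.map (Int.castRingHom ℚ)))
    (hψR : Polynomial.eval₂ (Int.castRingHom (CategoryTheory.End A)) (ψ : CategoryTheory.End A) R = 0)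
    (hψ' : pullbackOne A ψ' ∈ Algebra.adjoin ℂ ({pullbackOne A ψ} : Set (Module.End ℂ (complexBetti A.X 1))))
    (hadj : ∀ x y : complexBetti A.X 1, polarizationPairingOne A.X h (A.dim - 1) (pullbackOne A ψ x) y =
      polarizationPairingOne A.X h (A.dim - 1) x (pullbackOne A ψ' y))
    (hCM : ∀ σ : ℂ, (pullbackOne A ψ).eigenspace σ ⊓ (pullbackOne A ψ').eigenspace σ = ⊥)
    (hPm : P.Monic) (hPe : P.natDegree = e) (hPirr : Irreducible (P.map (Int.castRingHom ℚ)))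
    (hφ : Polynomial.eval₂ (Int.castRingHom (CategoryTheory.End (⨁ (fun _ : Fin (n + 1) => A))))
      (φ : CategoryTheory.End (⨁ (fun _ : Fin (n + 1) => A))) P = 0)
    (her : e * (2 * m) = 2 * ((n + 1) * A.dim)) (p : Fin (n + 1) → Fin (n + 1) → Polynomial ℤ)
    (hφp : ∀ a b, biproduct.ι (fun _ : Fin (n + 1) => A) a ≫ φ ≫ biproduct.π (fun _ : Fin (n + 1) => A) b =
      Polynomial.eval₂ (Int.castRingHom (CategoryTheory.End A)) (ψ : CategoryTheory.End A) (p a b))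
    (hbal : ∀ ρ : ℂ, Polynomial.eval₂ (Int.castRingHom ℂ) ρ P = 0 → ∀ σ : ℂ,
      Module.finrank ℂ ↥((pullbackOne (⨁ (fun _ : Fin (n + 1) => A)) φ).eigenspace ρ ⊓
        (pullbackOne (⨁ (fun _ : Fin (n + 1) => A)) (biproduct.map fun _ : Fin (n + 1) => ψ)).eigenspace σ) =
      Module.finrank ℂ ↥((pullbackOne (⨁ (fun _ : Fin (n + 1) => A)) φ).eigenspace ρ ⊓
        (pullbackOne (⨁ (fun _ : Fin (n + 1) => A)) (biproduct.map fun _ : Fin (n + 1) => ψ')).eigenspace σ)) :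
    weilClassesField (⨁ (fun _ : Fin (n + 1) => A)) φ P (2 * m) ≤ algebraicClasses (⨁ (fun _ : Fin (n + 1) => A)).X m :=
  (weilClassesField_biproduct_le_divisorClassesSpan_of_entry_eq_eval₂_of_forall_finrank_eq hA hh htop hnd hRm hRirr hψR hψ'
    hadj hCM hPm hPe hPirr hφ her p hφp hbal).trans
    (AbelianVariety.divisorClassesSpan_le_algebraicClasses _
      (fun b hb hb' ↦ lefschetzOneOne_rational_holds (AbelianVariety.isSmoothProjective_holds
        (A := ⨁ (fun _ : Fin (n + 1) => A))) b hb hb') m)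

end Powers

end Literature.AlgebraicGeometry.HodgeTheory

end
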